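import Summits.HodgeConjecture.CorCM.TwoGroupCaseAReduceLemmas
import HarnessLib

/-!
# Case A of the order-`32` base: reduction of family CA2 with `θ̄ = id` to the four free bits of CA2-Id

COR-CM (cell `pub-hodgecm2`), binder seat b04 (gen 37), count-neutral own lane «Galois-CM-type classification».  KERNEL ONLY:
theorems; no definition, no named fact, no `sorry`.  Pure group theory (A7-JUNCTION gen-37 addendum).  Raw relations
`a² = t^{α₁}c^{α₂}`, `b² = t^{β₁}c^{β₂}`, `ba = ab t^{γ₁}c^{γ₂}`, `x a x⁻¹ = t^{p₁}c^{q₁} a`, `x b x⁻¹ = t^{p₂}c^{q₂} b`,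
`x² = t^{p₃}c^{q₃}a^{e₅}` (the identity action on `C(t)/N`, `x² ∈ N ∪ Na`).  Since `θ = conj(x)` is an automorphism with
`θ² = conj(x²)`: `α₁ = β₁ = γ₁ = 0`, `p₁ = 0`, `p₂ = γ₂e₅`, `p₃ = q₁e₅`; after `a ↦ a t^{q₁}`, `b ↦ b t^{q₂}`, `x ↦ x t^{q₃}` the
relations become those of `exists_simple_degenerate_of_ca2_id` (`id_reduce`).

## References

* [Rotman1995] J. J. Rotman, *An Introduction to the Theory of Groups*, 4th ed., GTM 148, Ch. 5 and Ch. 7 (extensions).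
-/

namespace Summit.HodgeConjecture.CorCM.GaloisModels.CaseA

open Summit.HodgeConjecture.CorCM.GaloisTableLaws (zmod2_cases)

variable {G : Type*} [Group G]

/-- **Reduction to CA2-Id.**  See the module docstring. [cite: Rotman1995, Ch. 5 and Ch. 7] -/
theorem id_reduce {t c x a b : G} (hcc : c * c = 1) (hc1 : c ≠ 1) (hcen : ∀ g : G, c * g = g * c) (htt : t * t = 1)
    (hxt : x * t * x⁻¹ = t * c) (hat : a * t = t * a) (hbt : b * t = t * b)
    (ha : ∀ p q : ZMod 2, a ≠ t ^ p.val * c ^ q.val) (hb : ∀ p q i : ZMod 2, b ≠ t ^ p.val * (c ^ q.val * a ^ i.val))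
    {α₁ α₂ β₁ β₂ γ₁ γ₂ p₁ q₁ p₂ q₂ p₃ q₃ e₅ : ZMod 2}
    (haa : a * a = t ^ α₁.val * c ^ α₂.val) (hbb : b * b = t ^ β₁.val * c ^ β₂.val)
    (hba : b * a = a * b * (t ^ γ₁.val * c ^ γ₂.val))
    (hxa : x * a = t ^ p₁.val * c ^ q₁.val * a * x) (hxb : x * b = t ^ p₂.val * c ^ q₂.val * b * x)
    (hxx : x * x = t ^ p₃.val * c ^ q₃.val * a ^ e₅.val) :
    ∃ a' b' x' : G, a' * t = t * a' ∧ b' * t = t * b' ∧ (∀ p q : ZMod 2, a' ≠ t ^ p.val * c ^ q.val) ∧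
      (∀ p q i : ZMod 2, b' ≠ t ^ p.val * (c ^ q.val * a' ^ i.val)) ∧
      a' * a' = c ^ α₂.val ∧ b' * b' = c ^ β₂.val ∧ b' * a' = a' * b' * c ^ γ₂.val ∧
      x' * t * x'⁻¹ = t * c ∧ x' * a' = a' * x' ∧ x' * b' = t ^ (γ₂ * e₅).val * b' * x' ∧ x' * x' = a' ^ e₅.val := by
  have hv1 : (1 : ZMod 2).val = 1 := rfl
  have htc : t * c = c * t := (hcen t).symm
  have hxa' : x * a * x⁻¹ = t ^ p₁.val * c ^ q₁.val * a := by rw [hxa]; group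
  have hxb' : x * b * x⁻¹ = t ^ p₂.val * c ^ q₂.val * b := by rw [hxb]; group
  -- words in `t, c` commute with `a`, `b`
  have hwa : ∀ p q : ZMod 2, t ^ p.val * c ^ q.val * a = a * (t ^ p.val * c ^ q.val) := fun p q =>
    (((show Commute t a from hat.symm).pow_left _).mul_left ((show Commute c a from hcen a).pow_left _)).eq
  have hwb : ∀ p q : ZMod 2, t ^ p.val * c ^ q.val * b = b * (t ^ p.val * c ^ q.val) := fun p q =>
    (((show Commute t b from hbt.symm).pow_left _).mul_left ((show Commute c b from hcen b).pow_left _)).eq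
  -- (C1)–(C3): `α₁ = β₁ = γ₁ = 0`
  have hα := sq_bit_eq_zero hcc hc1 hcen htt hxt hat haa hxa'
  have hβ := sq_bit_eq_zero hcc hc1 hcen htt hxt hbt hbb hxb'
  have hγ := comm_bit_eq_zero hcc hc1 hcen htt hxt hat hbt hba hxa' hxb'
  subst hα; subst hβ; subst hγ
  rw [ZMod.val_zero, pow_zero, one_mul] at haa hbb hba
  -- `a^{e} b a^{-e} = b c^{γ₂ e}`
  have hab : a * b * a⁻¹ = b * c ^ γ₂.val := by
    have h1 : a * b = b * a * c ^ γ₂.val := by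
      rw [hba, mul_assoc, ← pow_add, GaloisTableLaws.pow_eq_pow_of_mod_eq c (n := 2) (by rw [pow_two, hcc])
        (show (γ₂.val + γ₂.val) % 2 = 0 % 2 by have := ZMod.val_lt γ₂; omega), pow_zero, mul_one]
    rw [h1, show b * a * c ^ γ₂.val * a⁻¹ = b * (a * c ^ γ₂.val) * a⁻¹ by group,
      ← ((show Commute c a from hcen a).pow_left _).eq]
    group
  have haeb : a ^ e₅.val * b * (a ^ e₅.val)⁻¹ = b * c ^ (γ₂ * e₅).val := by
    rcases zmod2_cases e₅ with rfl | rfl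
    · rw [ZMod.val_zero, mul_zero, ZMod.val_zero, pow_zero, pow_zero]; group
    · rw [hv1, mul_one, pow_one]; exact hab
  -- `x² g x⁻²` for `g = a, b`
  have hx2a : x * x * a * (x * x)⁻¹ = a * c ^ (0 : ZMod 2).val := by
    rw [hxx, ZMod.val_zero, pow_zero, mul_one]
    rw [show t ^ p₃.val * c ^ q₃.val * a ^ e₅.val * a * (t ^ p₃.val * c ^ q₃.val * a ^ e₅.val)⁻¹ =
      t ^ p₃.val * c ^ q₃.val * (a ^ e₅.val * a * (a ^ e₅.val)⁻¹) * (t ^ p₃.val * c ^ q₃.val)⁻¹ by group,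
      show a ^ e₅.val * a * (a ^ e₅.val)⁻¹ = a by group, hwa]
    group
  have hx2b : x * x * b * (x * x)⁻¹ = b * c ^ (γ₂ * e₅).val := by
    rw [hxx, show t ^ p₃.val * c ^ q₃.val * a ^ e₅.val * b * (t ^ p₃.val * c ^ q₃.val * a ^ e₅.val)⁻¹ =
      t ^ p₃.val * c ^ q₃.val * (a ^ e₅.val * b * (a ^ e₅.val)⁻¹) * (t ^ p₃.val * c ^ q₃.val)⁻¹ by group, haeb,
      show t ^ p₃.val * c ^ q₃.val * (b * c ^ (γ₂ * e₅).val) = (t ^ p₃.val * c ^ q₃.val * b) * c ^ (γ₂ * e₅).val by group,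
      hwb]
    rw [show b * (t ^ p₃.val * c ^ q₃.val) * c ^ (γ₂ * e₅).val * (t ^ p₃.val * c ^ q₃.val)⁻¹ =
      b * ((t ^ p₃.val * c ^ q₃.val) * c ^ (γ₂ * e₅).val * (t ^ p₃.val * c ^ q₃.val)⁻¹) by group]
    have hWc : Commute (t ^ p₃.val * c ^ q₃.val) (c ^ (γ₂ * e₅).val) :=
      ((show Commute t c from htc).pow_pow _ _).mul_left ((Commute.refl c).pow_pow _ _)
    rw [hWc.eq]; group
  -- (C4), (C5): `p₁ = 0`, `p₂ = γ₂ e₅`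
  have hp₁ := theta_sq_bit hcc hc1 hcen htt hxt hxa' hx2a
  have hp₂ := theta_sq_bit hcc hc1 hcen htt hxt hxb' hx2b
  subst hp₁; subst hp₂
  -- (C6): `p₃ = q₁ e₅` from `x (x²) x⁻¹ = x²`
  have hp₃ : p₃ = q₁ * e₅ := by
    have h1 : x * (x * x) * x⁻¹ = x * x := by group
    rw [hxx, show x * (t ^ p₃.val * c ^ q₃.val * a ^ e₅.val) * x⁻¹ =
      (x * (t ^ p₃.val * c ^ q₃.val) * x⁻¹) * (x * a * x⁻¹) ^ e₅.val by rw [conj_pow]; group,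
      conj_tc_word hcc hcen htc hxt, hxa', ZMod.val_zero, pow_zero, one_mul] at h1
    -- `(c^{q₁} a)^{e} = c^{q₁ e} a^{e}`
    rw [((show Commute c a from hcen a).pow_left _).mul_pow, ← pow_mul, show t ^ p₃.val * c ^ (p₃ + q₃).val *
      (c ^ (q₁.val * e₅.val) * a ^ e₅.val) = t ^ p₃.val * (c ^ (p₃ + q₃).val * c ^ (q₁.val * e₅.val)) * a ^ e₅.val
      by group] at h1
    have h2 := mul_left_cancel (mul_right_cancel h1)
    -- `c^{p₃+q₃} c^{q₁ e₅} = c^{q₃}`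
    have h3 : c ^ (p₃ + q₃ + q₁ * e₅).val = c ^ q₃.val := by
      rw [FrattiniTwo.invol_pow_add hcc (p₃ + q₃), ← h2]
      congr 1
      exact GaloisTableLaws.pow_eq_pow_of_mod_eq c (n := 2) (by rw [pow_two, hcc]) (by rw [ZMod.val_mul]; omega)
    have h4 := bit_eq_of_cpow_eq hcc hc1 h3
    have h5 : ∀ z w v : ZMod 2, z + w + v = w → z = v := by decide
    exact h5 _ _ _ h4
  subst hp₃
  -- the new generators
  refine ⟨a * t ^ q₁.val, b * t ^ q₂.val, x * t ^ q₃.val, ?_, ?_, not_word_mul_tpow htt htc ha q₁,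
    not_word₃_mul_tpow htt htc hat hb q₁ q₂, ?_, ?_, ?_, ?_, ?_, ?_, ?_⟩
  · rw [mul_assoc, ((Commute.refl t).pow_left _).eq, ← mul_assoc, hat, mul_assoc]
  · rw [mul_assoc, ((Commute.refl t).pow_left _).eq, ← mul_assoc, hbt, mul_assoc]
  · rw [sq_mul_tpow htt hat, haa]
  · rw [sq_mul_tpow htt hbt, hbb]
  · exact comm_mul_tpow hat hbt ((show Commute c t from hcen t).pow_left _).eq hba q₁ q₂
  · rw [conj_mul_tpow (mul_one t ▸ (one_mul t).symm ▸ rfl : t * t = t * t) q₃, hxt]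
  · have h := act_mul_tpow hcc hcen hxt hxa
    rw [ZMod.val_zero, pow_zero, one_mul] at h
    have hc : Commute (t ^ q₃.val) (a * t ^ q₁.val) :=
      ((show Commute t a from hat.symm).pow_left _).mul_right ((Commute.refl t).pow_pow _ _)
    calc x * t ^ q₃.val * (a * t ^ q₁.val) = x * (t ^ q₃.val * (a * t ^ q₁.val)) := mul_assoc _ _ _
      _ = x * ((a * t ^ q₁.val) * t ^ q₃.val) := by rw [hc.eq]
      _ = (x * (a * t ^ q₁.val)) * t ^ q₃.val := (mul_assoc _ _ _).symm
      _ = a * t ^ q₁.val * x * t ^ q₃.val := by rw [h]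
      _ = a * t ^ q₁.val * (x * t ^ q₃.val) := mul_assoc _ _ _
  · have h := act_mul_tpow hcc hcen hxt hxb
    have hc : Commute (t ^ q₃.val) (b * t ^ q₂.val) :=
      ((show Commute t b from hbt.symm).pow_left _).mul_right ((Commute.refl t).pow_pow _ _)
    calc x * t ^ q₃.val * (b * t ^ q₂.val) = x * (t ^ q₃.val * (b * t ^ q₂.val)) := mul_assoc _ _ _
      _ = x * ((b * t ^ q₂.val) * t ^ q₃.val) := by rw [hc.eq]
      _ = (x * (b * t ^ q₂.val)) * t ^ q₃.val := (mul_assoc _ _ _).symm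
      _ = t ^ (γ₂ * e₅).val * (b * t ^ q₂.val) * x * t ^ q₃.val := by rw [h]
      _ = t ^ (γ₂ * e₅).val * (b * t ^ q₂.val) * (x * t ^ q₃.val) := mul_assoc _ _ _
  · rw [xsq_mul_tpow hcc hcen htt hxt, hxx]
    -- `t^{q₁ e₅} c^{q₃} a^{e₅} c^{q₃} = (a t^{q₁})^{e₅}`
    rcases zmod2_cases e₅ with rfl | rfl
    · simp only [mul_zero, ZMod.val_zero, pow_zero, mul_one, one_mul]
      rw [← FrattiniTwo.invol_pow_add hcc, show (q₃ + q₃).val = 0 by rcases zmod2_cases q₃ with rfl | rfl <;> rfl, pow_zero]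
    · simp only [mul_one, hv1, pow_one]
      calc t ^ q₁.val * c ^ q₃.val * a * c ^ q₃.val = t ^ q₁.val * (c ^ q₃.val * (a * c ^ q₃.val)) := by group
        _ = t ^ q₁.val * (c ^ q₃.val * (c ^ q₃.val * a)) := by rw [((show Commute c a from hcen a).pow_left _).eq]
        _ = t ^ q₁.val * ((c ^ q₃.val * c ^ q₃.val) * a) := by group
        _ = t ^ q₁.val * a := by
            rw [← FrattiniTwo.invol_pow_add hcc, show (q₃ + q₃).val = 0 by rcases zmod2_cases q₃ with rfl | rfl <;> rfl,
              pow_zero, one_mul]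
        _ = a * t ^ q₁.val := ((show Commute t a from hat.symm).pow_left _).eq

end Summit.HodgeConjecture.CorCM.GaloisModels.CaseA
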